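import Mathlib
import Summits.Ventures.PercRepro2.Defs
import Summits.Ventures.PercRepro2.Independence
import Summits.Ventures.PercRepro2.Harris
import Summits.Ventures.PercRepro2.Graph
import Summits.Ventures.PercRepro2.Events
import Summits.Ventures.PercRepro2.Induced
import Summits.Ventures.PercRepro2.Frontier
import Summits.Ventures.PercRepro2.FourFunctions
import Summits.Ventures.PercRepro2.BTVFamilyDefs
import Summits.Ventures.PercRepro2.BTVFamilyReveal
import Summits.Ventures.PercRepro2.BTVFamilyTower
import Summits.Ventures.PercRepro2.BTVFamilyBase

/-!
# The merged V-family behind (B-T): the theorem (blind cell PercRepro2, mine-1 g52;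
paper proofs/MINE1-BT.md §2.2, §2.5)

`vfamily`: for every induced subgraph `G[U]` and all frontier sets `A₁, W₁, A₂, W₂ ⊆ U`,
`P(a(A₁,W₁)) · P(b(A₂,W₂)) ≤ P(j(A₁ ∪ A₂, W₁ ∩ W₂)) · P(m(A₁ ∩ A₂, W₁ ∪ W₂))`.  Induction on
`U`: while a vertex `z` lies in a frontier set of both left-hand cells, the edges at `z` are
revealed in both configurations and `z` is deleted (`BTVFamilyReveal`, `BTVFamilyTower`); the
four functions theorem on those edges — `j` at `ξ ⊔ ξ'`, `m` at `ξ ⊓ ξ'` for a `u`-vertex of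
both sides, the reversed orientation for a `w`-vertex of both sides, the identity or swap pairing
for a mixed vertex — and the induction hypothesis close the step, `m` being antitone in `A` and
`j` in `W`.  When no such vertex is left, `BTVFamilyBase.vfamily_base` applies.  `(B-T)` itself
is the singleton case (`BTVFamilyCorollary.lean`).
-/

namespace Summit.Ventures.PercRepro2

namespace BTVFamily

section Main

variable {V : Type*} {E : Type*} [Fintype E] [DecidableEq E] [Fintype V] [DecidableEq V]
  {R : Type*} [CommRing R] [LinearOrder R] [IsStrictOrderedRing R]

/-- **The merged V-family** (paper proofs/MINE1-BT.md, Theorem 2.2): for every induced subgraph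
`G[U]` and all frontier sets `A₁, W₁, A₂, W₂ ⊆ U`,
`P(a(A₁,W₁)) P(b(A₂,W₂)) ≤ P(j(A₁ ∪ A₂, W₁ ∩ W₂)) P(m(A₁ ∩ A₂, W₁ ∪ W₂))`. -/
theorem vfamily (p : E → R) (hp : IsProbVec p) (ends : E → Sym2 V) (s t v : V) (U : Finset V) :
    ∀ A₁ W₁ A₂ W₂ : Finset V, A₁ ⊆ U → W₁ ⊆ U → A₂ ⊆ U → W₂ ⊆ U →
      prob p (aEv ends U s t v A₁ W₁) * prob p (bEv ends U s t v A₂ W₂) ≤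
        prob p (jEv ends U s t v (A₁ ∪ A₂) (W₁ ∩ W₂)) *
          prob p (mEv ends U s t v (A₁ ∩ A₂) (W₁ ∪ W₂)) := by
  induction U using Finset.strongInduction with
  | H U ih =>
  intro A₁ W₁ A₂ W₂ hA₁ hW₁ hA₂ hW₂
  -- nonnegativity of the right side, for the degenerate cases
  have hR : 0 ≤ prob p (jEv ends U s t v (A₁ ∪ A₂) (W₁ ∩ W₂)) *
      prob p (mEv ends U s t v (A₁ ∩ A₂) (W₁ ∪ W₂)) :=
    mul_nonneg (prob_nonneg hp _) (prob_nonneg hp _)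
  by_cases hZ : (A₁ ∪ W₁) ∩ (A₂ ∪ W₂) = ∅
  · exact vfamily_base p hp ends s t v U A₁ W₁ A₂ W₂ hZ
  obtain ⟨z, hz⟩ := Finset.nonempty_iff_ne_empty.2 hZ
  obtain ⟨hz1, hz2⟩ := Finset.mem_inter.1 hz
  -- degenerate cases: a terminal or an overlap in the common frontier
  by_cases hzs : z = s
  · subst hzs
    rw [aEv_eq_empty_of_mem_s hz1, prob_empty, zero_mul]
    exact hR
  by_cases hzv : z = v
  · subst hzv
    rw [aEv_eq_empty_of_mem_v hz1, prob_empty, zero_mul]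
    exact hR
  by_cases hzt : z = t
  · subst hzt
    rw [bEv_eq_empty_of_mem_t hz2, prob_empty, mul_zero]
    exact hR
  by_cases hov1 : z ∈ A₁ ∧ z ∈ W₁
  · rw [aEv_eq_empty_of_overlap hov1.1 hov1.2, prob_empty, zero_mul]
    exact hR
  by_cases hov2 : z ∈ A₂ ∧ z ∈ W₂
  · rw [bEv_eq_empty_of_overlap hov2.1 hov2.2, prob_empty, mul_zero]
    exact hR
  -- the exploration step at `z`
  have hzU : z ∈ U := (Finset.mem_union.1 hz1).elim (fun h => hA₁ h) (fun h => hW₁ h)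
  have hU' : U \ {z} ⊂ U := Finset.sdiff_ssubset (Finset.singleton_subset_iff.2 hzU)
    (Finset.singleton_nonempty z)
  have hsub : ∀ {X : Finset V}, X ⊆ U → X.erase z ⊆ U \ {z} := fun {X} hX x hx => by
    rw [Finset.mem_sdiff, Finset.mem_singleton]
    exact ⟨hX (Finset.mem_of_mem_erase hx), Finset.ne_of_mem_erase hx⟩
  have hsub' : ∀ {X : Finset V}, X ⊆ U → z ∉ X → X ⊆ U \ {z} := fun {X} hX hzX x hx => by
    rw [Finset.mem_sdiff, Finset.mem_singleton]
    exact ⟨hX hx, fun h => hzX (h ▸ hx)⟩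
  have hfr : ∀ ω : Config E, frontier ends U {z} ω ⊆ U \ {z} := fun ω => frontier_subset ω
  have hnn : ∀ (X : Set (Config E)) (ω : Config E), 0 ≤ weight p ω * prob p X :=
    fun X ω => mul_nonneg (weight_nonneg hp ω) (prob_nonneg hp X)
  rcases Finset.mem_union.1 hz1 with hzA₁ | hzW₁ <;> rcases Finset.mem_union.1 hz2 with hzA₂ | hzW₂
  · -- (i) `z ∈ A₁ ∩ A₂`: four functions, `j` at `ξ ⊔ ξ'`, `m` at `ξ ⊓ ξ'`
    have hzW₁ : z ∉ W₁ := fun h => hov1 ⟨hzA₁, h⟩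
    have hzW₂ : z ∉ W₂ := fun h => hov2 ⟨hzA₂, h⟩
    rw [prob_aEv_reveal_A p ends hzU hzs hzt hzA₁ hzW₁, prob_bEv_reveal_A p ends hzU hzs hzt hzA₂ hzW₂,
      prob_jEv_reveal_A p ends hzU hzs hzt hzv (Finset.mem_union_left _ hzA₁)
        (fun h => hzW₁ (Finset.mem_inter.1 h).1),
      prob_mEv_reveal_A p ends hzU hzs hzt hzv (Finset.mem_inter.2 ⟨hzA₁, hzA₂⟩)
        (fun h => (Finset.mem_union.1 h).elim hzW₁ hzW₂),
      mul_comm (∑ ω, weight p ω * prob p (jEv _ _ _ _ _ _ _))]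
    refine four_functions_theorem_univ
      (fun ω => weight p ω * prob p (aEv ends (U \ {z}) s t v (A₁.erase z ∪ frontier ends U {z} ω) W₁))
      (fun ω => weight p ω * prob p (bEv ends (U \ {z}) s t v (A₂.erase z ∪ frontier ends U {z} ω) W₂))
      (fun ω => weight p ω * prob p (mEv ends (U \ {z}) s t v
        ((A₁ ∩ A₂).erase z ∪ frontier ends U {z} ω) (W₁ ∪ W₂)))
      (fun ω => weight p ω * prob p (jEv ends (U \ {z}) s t v
        ((A₁ ∪ A₂).erase z ∪ frontier ends U {z} ω) (W₁ ∩ W₂)))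
      (fun ω => hnn _ ω) (fun ω => hnn _ ω) (fun ω => hnn _ ω) (fun ω => hnn _ ω) ?_
    intro ω ω'
    have hIH := ih (U \ {z}) hU' (A₁.erase z ∪ frontier ends U {z} ω) W₁
      (A₂.erase z ∪ frontier ends U {z} ω') W₂ (Finset.union_subset (hsub hA₁) (hfr ω))
      (hsub' hW₁ hzW₁) (Finset.union_subset (hsub hA₂) (hfr ω')) (hsub' hW₂ hzW₂)
    have e3 : (A₁.erase z ∪ frontier ends U {z} ω) ∪ (A₂.erase z ∪ frontier ends U {z} ω') =
        (A₁ ∪ A₂).erase z ∪ frontier ends U {z} (ω ⊔ ω') := by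
      rw [frontier_sup, erase_union_union]
    have h4 : prob p (mEv ends (U \ {z}) s t v
        ((A₁.erase z ∪ frontier ends U {z} ω) ∩ (A₂.erase z ∪ frontier ends U {z} ω')) (W₁ ∪ W₂)) ≤
        prob p (mEv ends (U \ {z}) s t v ((A₁ ∩ A₂).erase z ∪ frontier ends U {z} (ω ⊓ ω'))
          (W₁ ∪ W₂)) :=
      prob_mono hp (mEv_anti_left ends _ s t v
        ((Finset.union_subset_union_right (frontier_inf_subset ω ω')).trans
          (erase_inter_subset A₁ A₂ _ _ z)) _)
    rw [e3] at hIH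
    calc weight p ω * prob p (aEv ends (U \ {z}) s t v (A₁.erase z ∪ frontier ends U {z} ω) W₁) *
          (weight p ω' * prob p (bEv ends (U \ {z}) s t v
            (A₂.erase z ∪ frontier ends U {z} ω') W₂))
        = (weight p ω * weight p ω') *
            (prob p (aEv ends (U \ {z}) s t v (A₁.erase z ∪ frontier ends U {z} ω) W₁) *
              prob p (bEv ends (U \ {z}) s t v (A₂.erase z ∪ frontier ends U {z} ω') W₂)) := by
          ring
      _ ≤ (weight p ω * weight p ω') *
            (prob p (jEv ends (U \ {z}) s t v ((A₁ ∪ A₂).erase z ∪ frontier ends U {z} (ω ⊔ ω'))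
                (W₁ ∩ W₂)) *
              prob p (mEv ends (U \ {z}) s t v ((A₁ ∩ A₂).erase z ∪ frontier ends U {z} (ω ⊓ ω'))
                (W₁ ∪ W₂))) :=
          mul_le_mul_of_nonneg_left (hIH.trans (mul_le_mul_of_nonneg_left h4 (prob_nonneg hp _)))
            (mul_nonneg (weight_nonneg hp ω) (weight_nonneg hp ω'))
      _ = weight p (ω ⊓ ω') * prob p (mEv ends (U \ {z}) s t v
            ((A₁ ∩ A₂).erase z ∪ frontier ends U {z} (ω ⊓ ω')) (W₁ ∪ W₂)) *
          (weight p (ω ⊔ ω') * prob p (jEv ends (U \ {z}) s t v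
            ((A₁ ∪ A₂).erase z ∪ frontier ends U {z} (ω ⊔ ω')) (W₁ ∩ W₂))) := by
          rw [← weight_inf_mul_weight_sup p ω ω']
          ring
  · -- (iii) `z ∈ A₁ ∩ W₂`: the identity pairing (`j` takes `ξ`, `m` takes `ξ'`)
    have hzW₁ : z ∉ W₁ := fun h => hov1 ⟨hzA₁, h⟩
    have hzA₂ : z ∉ A₂ := fun h => hov2 ⟨h, hzW₂⟩
    rw [prob_aEv_reveal_A p ends hzU hzs hzt hzA₁ hzW₁, prob_bEv_reveal_W p ends hzU hzs hzt hzA₂ hzW₂,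
      prob_jEv_reveal_A p ends hzU hzs hzt hzv (Finset.mem_union_left _ hzA₁)
        (fun h => hzW₁ (Finset.mem_inter.1 h).1),
      prob_mEv_reveal_W p ends hzU hzs hzt hzv (fun h => hzA₂ (Finset.mem_inter.1 h).2)
        (Finset.mem_union_right _ hzW₂), Finset.sum_mul_sum, Finset.sum_mul_sum]
    refine Finset.sum_le_sum fun ω _ => Finset.sum_le_sum fun ω' _ => ?_
    have hIH := ih (U \ {z}) hU' (A₁.erase z ∪ frontier ends U {z} ω) W₁ A₂
      (W₂.erase z ∪ frontier ends U {z} ω') (Finset.union_subset (hsub hA₁) (hfr ω))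
      (hsub' hW₁ hzW₁) (hsub' hA₂ hzA₂) (Finset.union_subset (hsub hW₂) (hfr ω'))
    have e3 : (A₁.erase z ∪ frontier ends U {z} ω) ∪ A₂ = (A₁ ∪ A₂).erase z ∪ frontier ends U {z} ω :=
      (erase_union_right hzA₂).symm
    have e4 : W₁ ∪ (W₂.erase z ∪ frontier ends U {z} ω') =
        (W₁ ∪ W₂).erase z ∪ frontier ends U {z} ω' := (erase_union_left hzW₁).symm
    rw [e3, e4] at hIH
    have h3 : prob p (jEv ends (U \ {z}) s t v ((A₁ ∪ A₂).erase z ∪ frontier ends U {z} ω)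
        (W₁ ∩ (W₂.erase z ∪ frontier ends U {z} ω'))) ≤
        prob p (jEv ends (U \ {z}) s t v ((A₁ ∪ A₂).erase z ∪ frontier ends U {z} ω) (W₁ ∩ W₂)) :=
      prob_mono hp (jEv_anti_right ends _ s t v _ (inter_subset_erase_union_right hzW₁))
    have h4 : prob p (mEv ends (U \ {z}) s t v ((A₁.erase z ∪ frontier ends U {z} ω) ∩ A₂)
        ((W₁ ∪ W₂).erase z ∪ frontier ends U {z} ω')) ≤
        prob p (mEv ends (U \ {z}) s t v (A₁ ∩ A₂) ((W₁ ∪ W₂).erase z ∪ frontier ends U {z} ω')) :=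
      prob_mono hp (mEv_anti_left ends _ s t v (inter_subset_erase_union_left hzA₂) _)
    calc weight p ω * prob p (aEv ends (U \ {z}) s t v (A₁.erase z ∪ frontier ends U {z} ω) W₁) *
          (weight p ω' * prob p (bEv ends (U \ {z}) s t v A₂
            (W₂.erase z ∪ frontier ends U {z} ω')))
        = (weight p ω * weight p ω') *
            (prob p (aEv ends (U \ {z}) s t v (A₁.erase z ∪ frontier ends U {z} ω) W₁) *
              prob p (bEv ends (U \ {z}) s t v A₂ (W₂.erase z ∪ frontier ends U {z} ω'))) := by
          ring
      _ ≤ (weight p ω * weight p ω') *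
            (prob p (jEv ends (U \ {z}) s t v ((A₁ ∪ A₂).erase z ∪ frontier ends U {z} ω)
                (W₁ ∩ W₂)) *
              prob p (mEv ends (U \ {z}) s t v (A₁ ∩ A₂)
                ((W₁ ∪ W₂).erase z ∪ frontier ends U {z} ω'))) :=
          mul_le_mul_of_nonneg_left (hIH.trans (mul_le_mul h3 h4 (prob_nonneg hp _)
            (prob_nonneg hp _))) (mul_nonneg (weight_nonneg hp ω) (weight_nonneg hp ω'))
      _ = weight p ω * prob p (jEv ends (U \ {z}) s t v
            ((A₁ ∪ A₂).erase z ∪ frontier ends U {z} ω) (W₁ ∩ W₂)) *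
          (weight p ω' * prob p (mEv ends (U \ {z}) s t v (A₁ ∩ A₂)
            ((W₁ ∪ W₂).erase z ∪ frontier ends U {z} ω'))) := by ring
  · -- (iv) `z ∈ W₁ ∩ A₂`: the swap pairing (`j` takes `ξ'`, `m` takes `ξ`)
    have hzA₁ : z ∉ A₁ := fun h => hov1 ⟨h, hzW₁⟩
    have hzW₂ : z ∉ W₂ := fun h => hov2 ⟨hzA₂, h⟩
    rw [prob_aEv_reveal_W p ends hzU hzs hzt hzA₁ hzW₁, prob_bEv_reveal_A p ends hzU hzs hzt hzA₂ hzW₂,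
      prob_jEv_reveal_A p ends hzU hzs hzt hzv (Finset.mem_union_right _ hzA₂)
        (fun h => hzW₂ (Finset.mem_inter.1 h).2),
      prob_mEv_reveal_W p ends hzU hzs hzt hzv (fun h => hzA₁ (Finset.mem_inter.1 h).1)
        (Finset.mem_union_left _ hzW₁), mul_comm (∑ ω, weight p ω * prob p (jEv _ _ _ _ _ _ _)),
      Finset.sum_mul_sum, Finset.sum_mul_sum]
    refine Finset.sum_le_sum fun ω _ => Finset.sum_le_sum fun ω' _ => ?_
    have hIH := ih (U \ {z}) hU' A₁ (W₁.erase z ∪ frontier ends U {z} ω)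
      (A₂.erase z ∪ frontier ends U {z} ω') W₂ (hsub' hA₁ hzA₁)
      (Finset.union_subset (hsub hW₁) (hfr ω)) (Finset.union_subset (hsub hA₂) (hfr ω'))
      (hsub' hW₂ hzW₂)
    have e3 : A₁ ∪ (A₂.erase z ∪ frontier ends U {z} ω') =
        (A₁ ∪ A₂).erase z ∪ frontier ends U {z} ω' := (erase_union_left hzA₁).symm
    have e4 : (W₁.erase z ∪ frontier ends U {z} ω) ∪ W₂ =
        (W₁ ∪ W₂).erase z ∪ frontier ends U {z} ω := (erase_union_right hzW₂).symm
    rw [e3, e4] at hIH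
    have h3 : prob p (jEv ends (U \ {z}) s t v ((A₁ ∪ A₂).erase z ∪ frontier ends U {z} ω')
        ((W₁.erase z ∪ frontier ends U {z} ω) ∩ W₂)) ≤
        prob p (jEv ends (U \ {z}) s t v ((A₁ ∪ A₂).erase z ∪ frontier ends U {z} ω') (W₁ ∩ W₂)) :=
      prob_mono hp (jEv_anti_right ends _ s t v _ (inter_subset_erase_union_left hzW₂))
    have h4 : prob p (mEv ends (U \ {z}) s t v (A₁ ∩ (A₂.erase z ∪ frontier ends U {z} ω'))
        ((W₁ ∪ W₂).erase z ∪ frontier ends U {z} ω)) ≤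
        prob p (mEv ends (U \ {z}) s t v (A₁ ∩ A₂) ((W₁ ∪ W₂).erase z ∪ frontier ends U {z} ω)) :=
      prob_mono hp (mEv_anti_left ends _ s t v (inter_subset_erase_union_right hzA₁) _)
    calc weight p ω * prob p (aEv ends (U \ {z}) s t v A₁ (W₁.erase z ∪ frontier ends U {z} ω)) *
          (weight p ω' * prob p (bEv ends (U \ {z}) s t v
            (A₂.erase z ∪ frontier ends U {z} ω') W₂))
        = (weight p ω * weight p ω') *
            (prob p (aEv ends (U \ {z}) s t v A₁ (W₁.erase z ∪ frontier ends U {z} ω)) *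
              prob p (bEv ends (U \ {z}) s t v (A₂.erase z ∪ frontier ends U {z} ω') W₂)) := by
          ring
      _ ≤ (weight p ω * weight p ω') *
            (prob p (jEv ends (U \ {z}) s t v ((A₁ ∪ A₂).erase z ∪ frontier ends U {z} ω')
                (W₁ ∩ W₂)) *
              prob p (mEv ends (U \ {z}) s t v (A₁ ∩ A₂)
                ((W₁ ∪ W₂).erase z ∪ frontier ends U {z} ω))) :=
          mul_le_mul_of_nonneg_left (hIH.trans (mul_le_mul h3 h4 (prob_nonneg hp _)
            (prob_nonneg hp _))) (mul_nonneg (weight_nonneg hp ω) (weight_nonneg hp ω'))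
      _ = weight p ω * prob p (mEv ends (U \ {z}) s t v (A₁ ∩ A₂)
            ((W₁ ∪ W₂).erase z ∪ frontier ends U {z} ω)) *
          (weight p ω' * prob p (jEv ends (U \ {z}) s t v
            ((A₁ ∪ A₂).erase z ∪ frontier ends U {z} ω') (W₁ ∩ W₂))) := by ring
  · -- (ii) `z ∈ W₁ ∩ W₂`: four functions with the orientation reversed
    have hzA₁ : z ∉ A₁ := fun h => hov1 ⟨h, hzW₁⟩
    have hzA₂ : z ∉ A₂ := fun h => hov2 ⟨h, hzW₂⟩
    rw [prob_aEv_reveal_W p ends hzU hzs hzt hzA₁ hzW₁, prob_bEv_reveal_W p ends hzU hzs hzt hzA₂ hzW₂,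
      prob_jEv_reveal_W p ends hzU hzs hzt hzv (fun h => (Finset.mem_union.1 h).elim hzA₁ hzA₂)
        (Finset.mem_inter.2 ⟨hzW₁, hzW₂⟩),
      prob_mEv_reveal_W p ends hzU hzs hzt hzv (fun h => hzA₁ (Finset.mem_inter.1 h).1)
        (Finset.mem_union_left _ hzW₁)]
    refine four_functions_theorem_univ
      (fun ω => weight p ω * prob p (aEv ends (U \ {z}) s t v A₁ (W₁.erase z ∪ frontier ends U {z} ω)))
      (fun ω => weight p ω * prob p (bEv ends (U \ {z}) s t v A₂ (W₂.erase z ∪ frontier ends U {z} ω)))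
      (fun ω => weight p ω * prob p (jEv ends (U \ {z}) s t v (A₁ ∪ A₂)
        ((W₁ ∩ W₂).erase z ∪ frontier ends U {z} ω)))
      (fun ω => weight p ω * prob p (mEv ends (U \ {z}) s t v (A₁ ∩ A₂)
        ((W₁ ∪ W₂).erase z ∪ frontier ends U {z} ω)))
      (fun ω => hnn _ ω) (fun ω => hnn _ ω) (fun ω => hnn _ ω) (fun ω => hnn _ ω) ?_
    intro ω ω'
    have hIH := ih (U \ {z}) hU' A₁ (W₁.erase z ∪ frontier ends U {z} ω) A₂
      (W₂.erase z ∪ frontier ends U {z} ω') (hsub' hA₁ hzA₁)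
      (Finset.union_subset (hsub hW₁) (hfr ω)) (hsub' hA₂ hzA₂)
      (Finset.union_subset (hsub hW₂) (hfr ω'))
    have e4 : (W₁.erase z ∪ frontier ends U {z} ω) ∪ (W₂.erase z ∪ frontier ends U {z} ω') =
        (W₁ ∪ W₂).erase z ∪ frontier ends U {z} (ω ⊔ ω') := by
      rw [frontier_sup, erase_union_union]
    have h3 : prob p (jEv ends (U \ {z}) s t v (A₁ ∪ A₂)
        ((W₁.erase z ∪ frontier ends U {z} ω) ∩ (W₂.erase z ∪ frontier ends U {z} ω'))) ≤
        prob p (jEv ends (U \ {z}) s t v (A₁ ∪ A₂)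
          ((W₁ ∩ W₂).erase z ∪ frontier ends U {z} (ω ⊓ ω'))) :=
      prob_mono hp (jEv_anti_right ends _ s t v _
        ((Finset.union_subset_union_right (frontier_inf_subset ω ω')).trans
          (erase_inter_subset W₁ W₂ _ _ z)))
    rw [e4] at hIH
    calc weight p ω * prob p (aEv ends (U \ {z}) s t v A₁ (W₁.erase z ∪ frontier ends U {z} ω)) *
          (weight p ω' * prob p (bEv ends (U \ {z}) s t v A₂
            (W₂.erase z ∪ frontier ends U {z} ω')))
        = (weight p ω * weight p ω') *
            (prob p (aEv ends (U \ {z}) s t v A₁ (W₁.erase z ∪ frontier ends U {z} ω)) *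
              prob p (bEv ends (U \ {z}) s t v A₂ (W₂.erase z ∪ frontier ends U {z} ω'))) := by
          ring
      _ ≤ (weight p ω * weight p ω') *
            (prob p (jEv ends (U \ {z}) s t v (A₁ ∪ A₂)
                ((W₁ ∩ W₂).erase z ∪ frontier ends U {z} (ω ⊓ ω'))) *
              prob p (mEv ends (U \ {z}) s t v (A₁ ∩ A₂)
                ((W₁ ∪ W₂).erase z ∪ frontier ends U {z} (ω ⊔ ω')))) :=
          mul_le_mul_of_nonneg_left (hIH.trans (mul_le_mul_of_nonneg_right h3 (prob_nonneg hp _)))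
            (mul_nonneg (weight_nonneg hp ω) (weight_nonneg hp ω'))
      _ = weight p (ω ⊓ ω') * prob p (jEv ends (U \ {z}) s t v (A₁ ∪ A₂)
            ((W₁ ∩ W₂).erase z ∪ frontier ends U {z} (ω ⊓ ω'))) *
          (weight p (ω ⊔ ω') * prob p (mEv ends (U \ {z}) s t v (A₁ ∩ A₂)
            ((W₁ ∪ W₂).erase z ∪ frontier ends U {z} (ω ⊔ ω')))) := by
          rw [← weight_inf_mul_weight_sup p ω ω']
          ring

end Main

end BTVFamily

end Summit.Ventures.PercRepro2
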